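import Mathlib
import HarnessLib
import Literature.Probability.MarkovChains.GroupRandomWalk

/-!
# A transitive chain and its time reversal are at the same distance from uniform: `‖P̂ᵗ(x,·) − π‖_TV = ‖Pᵗ(x,·) − π‖_TV` (Levin–Peres–Wilmer Lemma 4.16, Exercise 2.8)

HONEST FRAMING: exact (Metropolis-corrected) sampling algorithms for lattice gauge theory; figures
of merit are autocorrelation/cost numbers at stated couplings and volumes; no continuum-physics claim.

Source: D. A. Levin, Y. Peres (with E. L. Wilmer), *Markov Chains and Mixing Times*, 2nd ed., AMS
2017 [LevinPeres2017], Notes to Chapter 4, "Complements" (pp. 58–59): "The result of Lemma 4.13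
generalizes to transitive Markov chains" — LEMMA 4.16: for a transitive `P` with time reversal `P̂`
and `π` uniform, `‖P̂ᵗ(x,·) − π‖_TV = ‖Pᵗ(x,·) − π‖_TV` (4.46), proved by averaging over the state
space ((4.47)–(4.51)) and using EXERCISE 2.8 (§2.6.2, p. 34): "`P̂` is also transitive".
Vocabulary of `TransitiveChains.lean` (`IsTransitive`, eq. (2.15)), `GroupRandomWalk.lean`
(`timeReversal π P = P̂`, eq. (1.32); Prop. 1.23 `π(x)Pᵗ(x,y) = π(y)P̂ᵗ(y,x)`;
`tvDist_kernelAt_eq_of_isTransitive`, `worstTvDist_eq_of_isTransitive`; Lemma 4.13 / Cor. 4.14 are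
the random-walk-on-a-group case), `TotalVariation.lean` / `BottleneckRatio.lean` (`tvDist`,
`kernelAt`, `worstTvDist = d(t)`, `mixingTime = t_mix(ε)`).  Everything is PROVED (0 named facts,
0 definitions).

* `timeReversal_apply_of_const` — for a constant (uniform) `π`, `P̂(x,y) = P(y,x)`;
  `kernelAt_timeReversal_of_const` — `P̂ᵗ(x,y) = Pᵗ(y,x)` [cite: LevinPeres2017, Notes to Ch. 4,
  proof of Lemma 4.16 ("Because `π` is uniform, we have `P(y,z) = P̂(z,y)`, and thus
  `Pᵗ(y,z) = P̂ᵗ(z,y)`")];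
* **EXERCISE 2.8** `LevinPeres2017_exercise_2_8` — the time reversal (w.r.t. the uniform law) of a
  transitive transition matrix is transitive [cite: LevinPeres2017, §2.6.2 Exercise 2.8];
* **LEMMA 4.16 (4.46)** `LevinPeres2017_lemma_4_16` — `‖P̂ᵗ(x,·) − π‖_TV = ‖Pᵗ(x,·) − π‖_TV` for a
  transitive `P` and uniform `π` [cite: LevinPeres2017, Notes to Ch. 4, Lemma 4.16 eq. (4.46)];
  consequences `worstTvDist_timeReversal_of_isTransitive` (`d̂(t) = d(t)`) and
  `mixingTime_timeReversal_of_isTransitive` (`t̂_mix(ε) = t_mix(ε)`, the transitive form of Cor. 4.14)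
  [cite: LevinPeres2017, Notes to Ch. 4, Lemma 4.16 with §4.6 Cor. 4.14].

Context (cell pub-lqcd, venture LatticeQCDFlow): translation-invariant (transitive) non-reversible
update schemes — systematic sweeps, lifted / directed moves on a periodic lattice — mix exactly as
fast as their time reversals in total variation, although neither is reversible.
-/

namespace Literature.Probability.MarkovChains

open Finset Matrix

variable {X : Type*} [Fintype X] [DecidableEq X] {P : X → X → ℝ} {π : X → ℝ} {c : ℝ}

omit [Fintype X] [DecidableEq X] in
/-- For a constant `π ≡ c ≠ 0`, `P̂(x,y) = π(y)P(y,x)/π(x) = P(y,x)`.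
[cite: LevinPeres2017, Notes to Ch. 4, proof of Lemma 4.16 ("Because `π` is uniform, we have
`P(y,z) = P̂(z,y)`")] -/
theorem timeReversal_apply_of_const (hπu : ∀ x, π x = c) (hc : c ≠ 0) (x y : X) :
    timeReversal π P x y = P y x := by
  rw [timeReversal_apply, hπu, hπu, mul_div_assoc, mul_div_cancel₀ _ hc]

/-- Hence `P̂ᵗ(x,y) = Pᵗ(y,x)` for a constant `π`. [cite: LevinPeres2017, Notes to Ch. 4, proof of
Lemma 4.16 ("and thus `Pᵗ(y,z) = P̂ᵗ(z,y)`")] -/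
theorem kernelAt_timeReversal_of_const (hπu : ∀ x, π x = c) (hc : c ≠ 0) (t : ℕ) (x y : X) :
    kernelAt (timeReversal π P) t x y = kernelAt P t y x := by
  have hπ : ∀ z, π z ≠ 0 := fun z => by rw [hπu]; exact hc
  have h := LevinPeres2017_prop_1_23_kernelAt (P := P) hπ t y x
  rw [hπu, hπu] at h
  exact (mul_left_cancel₀ hc h).symm

omit [Fintype X] [DecidableEq X] in
/-- **EXERCISE 2.8.** When the transition matrix `P` of a Markov chain is transitive, the
transition matrix `P̂` of its time reversal (with respect to the uniform stationary law) is also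
transitive — the same bijections `φ_{(x,y)}` work, since `P̂(z,w) = P(w,z)`.
[cite: LevinPeres2017, §2.6.2 Exercise 2.8] -/
theorem LevinPeres2017_exercise_2_8 (hT : IsTransitive P) (hπu : ∀ x, π x = c) (hc : c ≠ 0) :
    IsTransitive (timeReversal π P) := by
  intro x y
  obtain ⟨φ, hφx, hφ⟩ := hT x y
  refine ⟨φ, hφx, fun z w => ?_⟩
  rw [timeReversal_apply_of_const hπu hc, timeReversal_apply_of_const hπu hc]
  exact hφ w z

/-- The averaging identity behind (4.49)–(4.51):
`Σ_y ‖Pᵗ(y,·) − π‖_TV = Σ_z ‖P̂ᵗ(z,·) − π‖_TV` (exchange the order of summation in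
`Σ_y Σ_z |Pᵗ(y,z) − |X|⁻¹| = Σ_y Σ_z |P̂ᵗ(z,y) − |X|⁻¹|`). [cite: LevinPeres2017, Notes to Ch. 4, proof
of Lemma 4.16 eqs. (4.49)–(4.50)] -/
theorem sum_tvDist_kernelAt_eq_sum_timeReversal (hπu : ∀ x, π x = c) (hc : c ≠ 0) (t : ℕ) :
    ∑ y, tvDist (kernelAt P t y) π = ∑ z, tvDist (kernelAt (timeReversal π P) t z) π := by
  unfold tvDist
  rw [← mul_sum, ← mul_sum, sum_comm]
  congr 1
  refine sum_congr rfl fun z _ => sum_congr rfl fun y _ => ?_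
  rw [kernelAt_timeReversal_of_const hπu hc, hπu, hπu]

/-- **LEMMA 4.16 (4.46).** Let `P` be the transition matrix of a transitive Markov chain with
state space `X`, let `P̂` be its time reversal, and let `π` be the uniform distribution on `X`.
Then `‖P̂ᵗ(x,·) − π‖_TV = ‖Pᵗ(x,·) − π‖_TV` for every `t` and `x`.  (Both sides do not depend on
`x` by transitivity — of `P̂` via Exercise 2.8 —, and their averages over `x` agree.)
[cite: LevinPeres2017, Notes to Ch. 4, Lemma 4.16 eq. (4.46)] -/
theorem LevinPeres2017_lemma_4_16 (hT : IsTransitive P)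
    (hπu : ∀ x, π x = (Fintype.card X : ℝ)⁻¹) (t : ℕ) (x : X) :
    tvDist (kernelAt (timeReversal π P) t x) π = tvDist (kernelAt P t x) π := by
  have hc : (Fintype.card X : ℝ)⁻¹ ≠ 0 :=
    inv_ne_zero (Nat.cast_ne_zero.2 (Fintype.card_pos_iff.2 ⟨x⟩).ne')
  have hT' : IsTransitive (timeReversal π P) := LevinPeres2017_exercise_2_8 hT hπu hc
  -- (4.49): both TV distances are constant in the starting state
  have hA : ∀ y, tvDist (kernelAt P t y) π = tvDist (kernelAt P t x) π :=
    fun y => tvDist_kernelAt_eq_of_isTransitive hT hπu t y x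
  have hB : ∀ z, tvDist (kernelAt (timeReversal π P) t z) π =
      tvDist (kernelAt (timeReversal π P) t x) π :=
    fun z => tvDist_kernelAt_eq_of_isTransitive hT' hπu t z x
  -- (4.50)–(4.51): the averages agree
  have h := sum_tvDist_kernelAt_eq_sum_timeReversal (P := P) hπu hc t
  simp_rw [hA, hB, sum_const, card_univ, nsmul_eq_mul] at h
  have hn : (Fintype.card X : ℝ) ≠ 0 := Nat.cast_ne_zero.2 (Fintype.card_pos_iff.2 ⟨x⟩).ne'
  exact (mul_left_cancel₀ hn h).symm

/-- `d̂(t) = d(t)` for a transitive chain and its time reversal (uniform `π`).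
[cite: LevinPeres2017, Notes to Ch. 4, Lemma 4.16 eq. (4.46)] -/
theorem worstTvDist_timeReversal_of_isTransitive (hT : IsTransitive P)
    (hπu : ∀ x, π x = (Fintype.card X : ℝ)⁻¹) (t : ℕ) :
    worstTvDist (timeReversal π P) π t = worstTvDist P π t := by
  rcases isEmpty_or_nonempty X with hX | ⟨⟨x⟩⟩
  · simp [worstTvDist]
  have hc : (Fintype.card X : ℝ)⁻¹ ≠ 0 :=
    inv_ne_zero (Nat.cast_ne_zero.2 (Fintype.card_pos_iff.2 ⟨x⟩).ne')
  rw [worstTvDist_eq_of_isTransitive (LevinPeres2017_exercise_2_8 hT hπu hc) hπu t x,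
    worstTvDist_eq_of_isTransitive hT hπu t x, LevinPeres2017_lemma_4_16 hT hπu t x]

/-- **`t̂_mix(ε) = t_mix(ε)`**: a transitive chain and its time reversal have the same mixing time
(the transitive form of Corollary 4.14). [cite: LevinPeres2017, Notes to Ch. 4, Lemma 4.16 with
§4.6 Cor. 4.14] -/
theorem mixingTime_timeReversal_of_isTransitive (hT : IsTransitive P)
    (hπu : ∀ x, π x = (Fintype.card X : ℝ)⁻¹) (ε : ℝ) :
    mixingTime (timeReversal π P) π ε = mixingTime P π ε := by
  unfold mixingTime
  congr 1
  ext t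
  simp only [Set.mem_setOf_eq]
  rw [worstTvDist_timeReversal_of_isTransitive hT hπu t]

end Literature.Probability.MarkovChains
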